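/-
Copyright (c) 2026. All rights reserved.
Released under Apache 2.0 license as described in the file LICENSE.
Authors: abc-iut cell, prover seat abc-iut-w5-d138 (wave 5, gen 8).
-/
import Literature.IUT.LogVolume.UnitLogDepthThreeDichotomy
import Literature.IUT.LogVolume.FundamentalIdentity
import HarnessLib

/-!
# [IUTchIII] Rmk 1.1.1 (i): the THIRD iterate of the log-link — `D_3 = ∅` versus `D_n ≠ ∅ ∀ n` at the SAME `(p, e, f)`

Proof-only companion (theorems, no definitions) of `LogLinkIterates.lean` (abc-iut-L6-t3/L6-d2: `iterDomain L n`
= the domain `D_n` of the `n`-th iterate of the log-link on the units, `D_0 = k`,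
`D_{n+1} = {x ∈ 𝒪_k^× | log_k x ∈ D_n}`; S. Mochizuki, *Inter-universal Teichmüller Theory III*, kurims
manuscript (May 2020), Rmk 1.1.1 (i) p. 28, Rmk 1.2.2 (iii) p. 37 [claim: Mochizuki2012, status: disputed;
cited record-only]) at the standard model `PadicLogOnUnits.ofUnitLog p K` (`log := log_p = unitLog`), after
abc-iut-w5-d017's DEPTH-`2` criterion (`p` odd: `D_2 ≠ ∅ ⟺ p ∣ e(K/ℚ_p)`, `LogLinkIteratesRamificationCriterion`)
and abc-iut-w5-d138 gen 4 (`πᵖ = p ⇒ D_n ≠ ∅ ∀ n`, `LogLinkIteratesWildPrime`).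

**The depth-`≥ 3` domains are NOT determined by the ramification invariants `(p, e, f)`.**  For `p` odd and
`K` with `e(K/ℚ_p) = p`, `f(K/ℚ_p) = 1` (so `D_2 ≠ ∅`), let `ϖ` be a norm uniformizer and `w := ϖᵖ/p + ϖ`
(a unit); by `UnitLogDepthThreeDichotomy` exactly one of the following holds:

* (a) `‖w^{p−1} − 1‖ ≤ ‖ϖ‖²` (`w ≡` a Teichmüller representative `(mod ϖ²)`): then **`D_3 = ∅`** — no unit
  survives two log-links — while `D_2 ∋ 1 + ϖ` (`iterDomain_three_eq_empty`, `iterDomain_add_three_eq_empty`);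
* (b) `‖w^{p−1} − 1‖ > ‖ϖ‖²`: then **`1 + ϖ ∈ D_n` for every `n`** (`one_add_pi_mem_iterDomain`), indeed every
  unit `u` with `‖u^{p−1} − 1‖ = ‖ϖ‖` lies in every `D_n`;

(`iterDomain_dichotomy`, hypotheses `absRamificationIdx p K = p`, `residueDegree p K = 1`, via the elementary
GAP / FROBENIUS form `iterDomain_dichotomy_elem`).  BOTH cases occur inside `ℚ̄_p` for every odd `p`, at
extensions of degree `p` with `e = p`, `f = 1` (`absRamificationIdx_eq_and_residueDegree_eq_of_finrank_le`:
any `K` with `[K : ℚ_p] ≤ p` containing `π` with `‖π‖ᵖ = p⁻¹`; `exists_subfield_root`: a root of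
`Xᵖ + mX − n` in `ℚ̄_p` generates such a `K`): (a) `K = ℚ_p(π)`, `πᵖ + pπ − p = 0`
(`exists_subfield_iterDomain_three_eq_empty`); (b) `K = ℚ_p(p^{1/p})`
(`exists_subfield_forall_iterDomain_nonempty'`); together `exists_subfields_depth_three_differs`.

Consequence for the cell's (Ind3) census ([IUTchIII] Rmk 1.1.1 (i) iterates at the honest model): at a place
`v` with `p_v` odd and `p_v ∣ e(v|p_v)` the depth-`2` clause is inhabited (abc-iut-w5-d017), but whether the
depth-`m′ ≥ 3` clauses are `∅ ⊆ _` depends on `K_v` beyond `(p_v, e, f)`.  Classical `p`-adic analysis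
(Neukirch, *Algebraic Number Theory*, Ch. II (5.5)); no side taken on [IUTchIII] Cor. 3.12; census ≠ verdict.
-/

noncomputable section

open Metric Set IsLocalRing
open scoped NormedField

namespace Literature.IUT.LogThetaLattice

namespace DepthThree

open Literature.IUT.LogVolume Literature.IUT.LogVolume.DepthThree Literature.AnabelianGeometry.AbsoluteAnabelian
open Literature.NumberTheory.GaloisRepresentations.Ultrametric

variable (p : ℕ) [hp : Fact p.Prime]
variable {K : Type*} [NontriviallyNormedField K] [instK : NormedAlgebra ℚ_[p] K] [IsUltrametricDist K]
  [CompleteSpace K]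
variable {π : K}

/-! ### §1. Elementary form (GAP + FROBENIUS hypotheses) -/

/-- **IUTchIII:Rmk1.1.1(i)** (kurims p.28) `D_3 ⊆ {u : ‖u‖ = ‖log u‖ = ‖log log u‖ = 1}` — in fact equality — at
the standard model. [claim: Mochizuki2012, status: disputed] -/
theorem mem_iterDomain_three_iff (u : K) :
    u ∈ iterDomain (PadicLogOnUnits.ofUnitLog p K) 3 ↔
      ‖u‖ = 1 ∧ ‖unitLog u‖ = 1 ∧ ‖unitLog (unitLog u)‖ = 1 := by
  simp only [show (3 : ℕ) = 0 + 1 + 1 + 1 from rfl, mem_iterDomain_succ, iterDomain_zero, mem_univ, and_true,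
    mem_sphere_zero_iff_norm, PadicLogOnUnits.ofUnitLog_log]

/-- **IUTchIII:Rmk1.1.1(i)** (kurims p.28) CASE (a) (`p` odd, `‖π‖ᵖ = p⁻¹`, gap, Frobenius,
`‖(πᵖ/p + π)^{p−1} − 1‖ ≤ ‖π‖²`): **the third iterate of the log-link has EMPTY domain, `D_3 = ∅`.**
[claim: Mochizuki2012, status: disputed] -/
theorem iterDomain_three_eq_empty_elem (hp2 : p ≠ 2) (hπ : ‖π‖ ^ p = (p : ℝ)⁻¹)
    (hgap : ∀ x : K, ‖x‖ < 1 → ‖x‖ ≤ ‖π‖) (hfrob : ∀ t : K, ‖t‖ ≤ 1 → ‖t ^ p - t‖ < 1)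
    (ha : ‖(π ^ p / (p : K) + π) ^ (p - 1) - 1‖ ≤ ‖π‖ ^ 2) :
    iterDomain (PadicLogOnUnits.ofUnitLog p K) 3 = ∅ := by
  ext u
  rw [mem_iterDomain_three_iff, mem_empty_iff_false, iff_false]
  rintro ⟨hu, h1, h2⟩
  have := norm_unitLog_unitLog_lt_one hp2 hπ hgap hfrob ha hu h1
  rw [h2] at this
  exact lt_irrefl _ this

/-- **IUTchIII:Rmk1.1.1(i)** (kurims p.28) … hence `D_{n+3} = ∅` for all `n` in CASE (a).
[claim: Mochizuki2012, status: disputed] -/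
theorem iterDomain_add_three_eq_empty_elem (hp2 : p ≠ 2) (hπ : ‖π‖ ^ p = (p : ℝ)⁻¹)
    (hgap : ∀ x : K, ‖x‖ < 1 → ‖x‖ ≤ ‖π‖) (hfrob : ∀ t : K, ‖t‖ ≤ 1 → ‖t ^ p - t‖ < 1)
    (ha : ‖(π ^ p / (p : K) + π) ^ (p - 1) - 1‖ ≤ ‖π‖ ^ 2) (n : ℕ) :
    iterDomain (PadicLogOnUnits.ofUnitLog p K) (n + 3) = ∅ := by
  induction n with
  | zero => exact iterDomain_three_eq_empty_elem p hp2 hπ hgap hfrob ha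
  | succ n ih =>
    exact subset_empty_iff.mp ((iterDomain_succ_subset _ (n + 3)).trans ih.subset)

/-- **IUTchIII:Rmk1.1.1(i)** (kurims p.28) … while the SECOND iterate is inhabited there: `1 + π ∈ D_2` (`p ∣ e`).
[claim: Mochizuki2012, status: disputed] -/
theorem one_add_pi_mem_iterDomain_two_elem (hp2 : p ≠ 2) (hπ : ‖π‖ ^ p = (p : ℝ)⁻¹)
    (hgap : ∀ x : K, ‖x‖ < 1 → ‖x‖ ≤ ‖π‖) (hfrob : ∀ t : K, ‖t‖ ≤ 1 → ‖t ^ p - t‖ < 1) :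
    1 + π ∈ iterDomain (PadicLogOnUnits.ofUnitLog p K) 2 := by
  have h1 : ‖(1 : K) + π‖ = 1 := by
    have hlt : ‖π‖ < ‖(1 : K)‖ := by rw [norm_one]; exact norm_pi_lt_one hπ
    rw [IsUltrametricDist.norm_add_eq_max_of_norm_ne_norm (ne_of_gt hlt), max_eq_left hlt.le, norm_one]
  simp only [show (2 : ℕ) = 0 + 1 + 1 from rfl, mem_iterDomain_succ, iterDomain_zero, mem_univ, and_true,
    mem_sphere_zero_iff_norm, PadicLogOnUnits.ofUnitLog_log]
  exact ⟨h1, norm_unitLog_one_add_pi_eq_one hp2 hπ hgap hfrob⟩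

/-- **IUTchIII:Rmk1.1.1(i)** (kurims p.28) CASE (b) (`‖(πᵖ/p + π)^{p−1} − 1‖ > ‖π‖²`): every unit `u` with
`‖u^{p−1} − 1‖ = ‖π‖` lies in EVERY `D_n`. [claim: Mochizuki2012, status: disputed] -/
theorem mem_iterDomain_of_caseB_elem (hp2 : p ≠ 2) (hπ : ‖π‖ ^ p = (p : ℝ)⁻¹)
    (hgap : ∀ x : K, ‖x‖ < 1 → ‖x‖ ≤ ‖π‖) (hfrob : ∀ t : K, ‖t‖ ≤ 1 → ‖t ^ p - t‖ < 1)
    (hb : ‖π‖ ^ 2 < ‖(π ^ p / (p : K) + π) ^ (p - 1) - 1‖) (n : ℕ) :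
    ∀ {u : K}, ‖u‖ = 1 → ‖u ^ (p - 1) - 1‖ = ‖π‖ → u ∈ iterDomain (PadicLogOnUnits.ofUnitLog p K) n := by
  induction n with
  | zero => intro u _ _; simp
  | succ n ih =>
    intro u hu hux
    rw [mem_iterDomain_succ, PadicLogOnUnits.ofUnitLog_log]
    have h := norm_pow_unitLog_sub_one_eq hp2 hπ hgap hfrob hb hu hux
    exact ⟨mem_sphere_zero_iff_norm.mpr hu, ih h.1 h.2⟩

/-- **IUTchIII:Rmk1.1.1(i)** (kurims p.28) CASE (b): **`1 + π ∈ D_n` for every `n`** — no iterate of the log-link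
has empty domain. [claim: Mochizuki2012, status: disputed] -/
theorem one_add_pi_mem_iterDomain_elem (hp2 : p ≠ 2) (hπ : ‖π‖ ^ p = (p : ℝ)⁻¹)
    (hgap : ∀ x : K, ‖x‖ < 1 → ‖x‖ ≤ ‖π‖) (hfrob : ∀ t : K, ‖t‖ ≤ 1 → ‖t ^ p - t‖ < 1)
    (hb : ‖π‖ ^ 2 < ‖(π ^ p / (p : K) + π) ^ (p - 1) - 1‖) (n : ℕ) :
    1 + π ∈ iterDomain (PadicLogOnUnits.ofUnitLog p K) n := by
  have h1 : ‖(1 : K) + π‖ = 1 := by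
    have hlt : ‖π‖ < ‖(1 : K)‖ := by rw [norm_one]; exact norm_pi_lt_one hπ
    rw [IsUltrametricDist.norm_add_eq_max_of_norm_ne_norm (ne_of_gt hlt), max_eq_left hlt.le, norm_one]
  exact mem_iterDomain_of_caseB_elem p hp2 hπ hgap hfrob hb n h1 (norm_one_add_pi_pow_sub_one_eq hπ)

/-- **IUTchIII:Rmk1.1.1(i)** (kurims p.28) **DICHOTOMY (elementary form):** for `p` odd, `‖π‖ᵖ = p⁻¹`, gap and
Frobenius, EITHER every iterate of the log-link from the third on has EMPTY domain, OR every iterate has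
inhabited domain. [claim: Mochizuki2012, status: disputed] -/
theorem iterDomain_dichotomy_elem (hp2 : p ≠ 2) (hπ : ‖π‖ ^ p = (p : ℝ)⁻¹)
    (hgap : ∀ x : K, ‖x‖ < 1 → ‖x‖ ≤ ‖π‖) (hfrob : ∀ t : K, ‖t‖ ≤ 1 → ‖t ^ p - t‖ < 1) :
    (∀ n, iterDomain (PadicLogOnUnits.ofUnitLog p K) (n + 3) = ∅) ∨
      (∀ n, (iterDomain (PadicLogOnUnits.ofUnitLog p K) n).Nonempty) := by
  rcases caseA_or_caseB hπ hgap hfrob with ha | hb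
  · exact Or.inl (iterDomain_add_three_eq_empty_elem p hp2 hπ hgap hfrob ha)
  · exact Or.inr fun n => ⟨1 + π, one_add_pi_mem_iterDomain_elem p hp2 hπ hgap hfrob hb n⟩

/-! ### §2. From the invariants `e(K/ℚ_p) = p`, `f(K/ℚ_p) = 1` to the elementary hypotheses -/

section Invariants

variable [ProperSpace K]

omit instK [IsUltrametricDist K] [CompleteSpace K] [ProperSpace K] in
/-- `‖π‖ = p^{−1/p}` when `‖π‖ᵖ = p⁻¹`. [cite: NeukirchANT1999, Ch. II (5.5)] -/
theorem norm_pi_eq_rpow (hπ : ‖π‖ ^ p = (p : ℝ)⁻¹) : ‖π‖ = (p : ℝ) ^ (-(1 / (p : ℝ))) := by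
  have hp0 : (0 : ℝ) ≤ p := by positivity
  calc ‖π‖ = (‖π‖ ^ p) ^ ((p : ℝ)⁻¹) := (Real.pow_rpow_inv_natCast (norm_nonneg _) hp.out.ne_zero).symm
    _ = ((p : ℝ)⁻¹) ^ ((p : ℝ)⁻¹) := by rw [hπ]
    _ = (p : ℝ) ^ (-(1 / (p : ℝ))) := by
        rw [Real.inv_rpow hp0, ← Real.rpow_neg hp0, one_div]

omit [CompleteSpace K] in
/-- **`e = p` gives the GAP hypothesis**: `‖x‖ < 1 ⇒ ‖x‖ ≤ p^{−1/e} = ‖π‖` (abc-iut-S1's discreteness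
`norm_le_rpow_of_norm_lt_one`). [cite: NeukirchANT1999, Ch. II (5.5)] -/
theorem gap_of_absRamificationIdx_eq (he : absRamificationIdx p K = p) (hπ : ‖π‖ ^ p = (p : ℝ)⁻¹) :
    ∀ x : K, ‖x‖ < 1 → ‖x‖ ≤ ‖π‖ := by
  intro x hx
  have h := norm_le_rpow_of_norm_lt_one p K hx
  rwa [he, ← norm_pi_eq_rpow p hπ] at h

omit [CompleteSpace K] in
/-- **`f = 1` gives the FROBENIUS hypothesis**: the residue field has `p` elements, so `t̄ᵖ = t̄`, i.e.
`‖tᵖ − t‖ < 1` for `‖t‖ ≤ 1`. [cite: NeukirchANT1999, Ch. II (5.5)] -/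
theorem frob_of_residueDegree_eq (hf : residueDegree p K = 1) :
    ∀ t : K, ‖t‖ ≤ 1 → ‖t ^ p - t‖ < 1 := by
  intro t ht
  haveI : Finite (ResidueField (Valued.integer K)) := finite_residueField
  letI : Fintype (ResidueField (Valued.integer K)) := Fintype.ofFinite _
  have hcard : Fintype.card (ResidueField (Valued.integer K)) = p := by
    rw [← Nat.card_eq_fintype_card, card_residueField p K, hf, pow_one]
  set T : Valued.integer K := ⟨t, Valued.integer.mem_iff.mpr ht⟩ with hT
  have hres : residue (Valued.integer K) (T ^ p - T) = 0 := by
    rw [map_sub, map_pow, ← hcard, FiniteField.pow_card, sub_self]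
  have hmem : T ^ p - T ∈ maximalIdeal (Valued.integer K) := (residue_eq_zero_iff _).mp hres
  have h := (mem_maximalIdeal_iff_norm_lt_one _).mp hmem
  have hcoe : ‖T ^ p - T‖ = ‖t ^ p - t‖ := by
    change ‖((T ^ p - T : Valued.integer K) : K)‖ = _
    push_cast
    rw [hT]
  rwa [hcoe] at h

omit [CompleteSpace K] in
/-- At `e = p` every norm uniformizer `ϖ` has `‖ϖ‖ᵖ = p⁻¹`. [cite: NeukirchANT1999, Ch. II (5.5)] -/
theorem norm_uniformizer_pow (he : absRamificationIdx p K = p) {ϖ : Kˣ} (hϖ : IsUniformizer ϖ) :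
    ‖(ϖ : K)‖ ^ p = (p : ℝ)⁻¹ := by
  have h := norm_pow_absRamificationIdx p K hϖ
  rwa [he] at h

/-- **IUTchIII:Rmk1.1.1(i)** (kurims p.28) **DICHOTOMY at `e(K/ℚ_p) = p`, `f(K/ℚ_p) = 1` (`p` odd)**: either
`D_{n+3} = ∅` for all `n` (no unit survives two log-links) or `D_n ≠ ∅` for all `n` — decided by the class of
`ϖᵖ/p + ϖ` modulo `ϖ²` (`UnitLogDepthThreeDichotomy`), NOT by `(p, e, f)`. [claim: Mochizuki2012, status: disputed] -/
theorem iterDomain_dichotomy (hp2 : p ≠ 2) (he : absRamificationIdx p K = p) (hf : residueDegree p K = 1) :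
    (∀ n, iterDomain (PadicLogOnUnits.ofUnitLog p K) (n + 3) = ∅) ∨
      (∀ n, (iterDomain (PadicLogOnUnits.ofUnitLog p K) n).Nonempty) := by
  obtain ⟨ϖ, hϖ⟩ := exists_isUniformizer (F := K)
  have hπ := norm_uniformizer_pow p he hϖ
  exact iterDomain_dichotomy_elem p hp2 hπ (gap_of_absRamificationIdx_eq p he hπ) (frob_of_residueDegree_eq p hf)

/-- **IUTchIII:Rmk1.1.1(i)** (kurims p.28) CASE (a) at `e = p`, `f = 1`: if some `π` with `‖π‖ᵖ = p⁻¹` (i.e. some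
uniformizer) has `‖(πᵖ/p + π)^{p−1} − 1‖ ≤ ‖π‖²`, then `D_3 = ∅` (and `D_2 ∋ 1 + π`).
[claim: Mochizuki2012, status: disputed] -/
theorem iterDomain_three_eq_empty (hp2 : p ≠ 2) (he : absRamificationIdx p K = p)
    (hf : residueDegree p K = 1) (hπ : ‖π‖ ^ p = (p : ℝ)⁻¹)
    (ha : ‖(π ^ p / (p : K) + π) ^ (p - 1) - 1‖ ≤ ‖π‖ ^ 2) :
    iterDomain (PadicLogOnUnits.ofUnitLog p K) 3 = ∅ ∧ 1 + π ∈ iterDomain (PadicLogOnUnits.ofUnitLog p K) 2 :=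
  ⟨iterDomain_three_eq_empty_elem p hp2 hπ (gap_of_absRamificationIdx_eq p he hπ) (frob_of_residueDegree_eq p hf) ha,
    one_add_pi_mem_iterDomain_two_elem p hp2 hπ (gap_of_absRamificationIdx_eq p he hπ)
      (frob_of_residueDegree_eq p hf)⟩

/-- **IUTchIII:Rmk1.1.1(i)** (kurims p.28) CASE (b) at `e = p`, `f = 1`: if `‖(πᵖ/p + π)^{p−1} − 1‖ > ‖π‖²` then
`1 + π ∈ D_n` for all `n`. [claim: Mochizuki2012, status: disputed] -/
theorem one_add_pi_mem_iterDomain (hp2 : p ≠ 2) (he : absRamificationIdx p K = p)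
    (hf : residueDegree p K = 1) (hπ : ‖π‖ ^ p = (p : ℝ)⁻¹)
    (hb : ‖π‖ ^ 2 < ‖(π ^ p / (p : K) + π) ^ (p - 1) - 1‖) (n : ℕ) :
    1 + π ∈ iterDomain (PadicLogOnUnits.ofUnitLog p K) n :=
  one_add_pi_mem_iterDomain_elem p hp2 hπ (gap_of_absRamificationIdx_eq p he hπ) (frob_of_residueDegree_eq p hf)
    hb n

omit [CompleteSpace K] in
/-- **`[K : ℚ_p] ≤ p` and `‖π‖ᵖ = p⁻¹` for some `π ∈ K` ⇒ `e(K/ℚ_p) = p` and `f(K/ℚ_p) = 1`** (discreteness: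
`p⁻¹ = ‖π‖ᵖ ≤ p^{−p/e}` gives `p ≤ e`; then `e·f = [K : ℚ_p] ≤ p`, abc-iut-S1's fundamental identity).
[cite: NeukirchANT1999, Ch. II (5.5)] -/
theorem absRamificationIdx_eq_and_residueDegree_eq_of_finrank_le (hfin : Module.finrank ℚ_[p] K ≤ p)
    (hπ : ‖π‖ ^ p = (p : ℝ)⁻¹) : absRamificationIdx p K = p ∧ residueDegree p K = 1 := by
  have hp0 : (0 : ℝ) < p := by exact_mod_cast hp.out.pos
  have hp1 : (1 : ℝ) < p := by exact_mod_cast hp.out.one_lt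
  set e := absRamificationIdx p K with he
  set f := residueDegree p K with hf
  have he0 : 0 < e := absRamificationIdx_pos p K
  have hf0 : 0 < f := residueDegree_pos p K
  have hef : e * f = Module.finrank ℚ_[p] K := absRamificationIdx_mul_residueDegree p K
  -- `p ≤ e` from `‖π‖ ≤ p^{-1/e}`
  have hle : ‖π‖ ≤ (p : ℝ) ^ (-(1 / (e : ℝ))) := norm_le_rpow_of_norm_lt_one p K (norm_pi_lt_one hπ)
  have hpe : p ≤ e := by
    have h1 : ‖π‖ ^ p ≤ ((p : ℝ) ^ (-(1 / (e : ℝ)))) ^ p := pow_le_pow_left₀ (norm_nonneg _) hle p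
    rw [hπ, ← Real.rpow_natCast, ← Real.rpow_mul hp0.le, ← Real.rpow_neg_one] at h1
    have h2 := (Real.rpow_le_rpow_left_iff hp1).mp h1
    have he' : (0 : ℝ) < e := by exact_mod_cast he0
    have h3 : (p : ℝ) / e ≤ 1 := by
      have : -(1 / (e : ℝ)) * p = -((p : ℝ) / e) := by ring
      rw [this] at h2
      linarith
    have h4 : (p : ℝ) ≤ e := by rwa [div_le_one he'] at h3
    exact_mod_cast h4
  have hfin' : e * f ≤ p := by rw [hef]; exact hfin
  have h5 : e ≤ e * f := Nat.le_mul_of_pos_right e hf0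
  have hep : e = p := le_antisymm (h5.trans hfin') hpe
  refine ⟨hep, ?_⟩
  have h6 : p * f ≤ p * 1 := by
    rw [mul_one]
    calc p * f = e * f := by rw [hep]
      _ ≤ p := hfin'
  exact le_antisymm (Nat.le_of_mul_le_mul_left h6 hp.out.pos) hf0

end Invariants

/-! ### §3. Both cases occur inside `ℚ̄_p`, at `e = p`, `f = 1` -/

open Polynomial IntermediateField in
/-- A root in `ℚ̄_p` of `Xᵖ + mX − n` (`m, n ∈ ℕ`) generates a finite `E ⊆ ℚ̄_p` with `[E : ℚ_p] ≤ p`.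
[cite: NeukirchANT1999, Ch. II (5.5)] -/
theorem exists_subfield_root (m n : ℕ) :
    ∃ (E : IntermediateField ℚ_[p] (PadicAlgCl p)) (_ : FiniteDimensional ℚ_[p] E),
      Module.finrank ℚ_[p] E ≤ p ∧ ∃ π : E, π ^ p + (m : E) * π = (n : E) := by
  set q : ℚ_[p][X] := X ^ p + (C (m : ℚ_[p]) * X - C (n : ℚ_[p])) with hq
  have hXp : degree ((X : ℚ_[p][X]) ^ p) = p := degree_X_pow p
  have hdeg : degree (C (m : ℚ_[p]) * X - C (n : ℚ_[p])) < (p : WithBot ℕ) := by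
    refine (degree_sub_le _ _).trans_lt (max_lt ?_ ?_)
    · exact (degree_C_mul_X_le (m : ℚ_[p])).trans_lt (by exact_mod_cast hp.out.one_lt)
    · exact degree_C_le.trans_lt (by exact_mod_cast hp.out.pos)
  have hmonic : q.Monic := monic_X_pow_add hdeg
  have hqdeg : q.degree = p := by
    rw [hq, degree_add_eq_left_of_degree_lt (by rwa [hXp]), hXp]
  have hqdeg0 : q.degree ≠ 0 := by rw [hqdeg]; exact_mod_cast hp.out.ne_zero
  obtain ⟨α, hα⟩ := IsAlgClosed.exists_aeval_eq_zero (PadicAlgCl p) q hqdeg0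
  have hint : IsIntegral ℚ_[p] α := ⟨q, hmonic, by simpa [aeval_def] using hα⟩
  haveI hfd : FiniteDimensional ℚ_[p] ℚ_[p]⟮α⟯ := adjoin.finiteDimensional hint
  refine ⟨ℚ_[p]⟮α⟯, hfd, ?_, ⟨α, mem_adjoin_simple_self ℚ_[p] α⟩, ?_⟩
  · rw [adjoin.finrank hint]
    have h1 : (minpoly ℚ_[p] α).degree ≤ q.degree := minpoly.min ℚ_[p] α hmonic hα
    rw [hqdeg] at h1
    exact natDegree_le_iff_degree_le.mpr h1
  · have hα' : α ^ p + (m : PadicAlgCl p) * α = (n : PadicAlgCl p) := by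
      have : aeval α q = α ^ p + ((m : PadicAlgCl p) * α - (n : PadicAlgCl p)) := by
        simp only [hq, map_add, map_sub, map_mul, map_pow, aeval_X, map_natCast]
      rw [this] at hα
      linear_combination hα
    apply Subtype.ext
    push_cast
    exact hα'

variable {p} in
/-- **CASE (a) occurs: for every odd `p`, `E = ℚ_p(π) ⊆ ℚ̄_p` with `πᵖ + pπ − p = 0` has `e = p`, `f = 1`,
`[E : ℚ_p] ≤ p`, `D_2 ≠ ∅` and `D_3 = ∅`.** [claim: Mochizuki2012, status: disputed] -/
theorem exists_subfield_iterDomain_three_eq_empty (hp2 : p ≠ 2) :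
    ∃ (E : IntermediateField ℚ_[p] (PadicAlgCl p)) (_ : FiniteDimensional ℚ_[p] E),
      absRamificationIdx p E = p ∧ residueDegree p E = 1 ∧
        (iterDomain (PadicLogOnUnits.ofUnitLog p E) 2).Nonempty ∧
          iterDomain (PadicLogOnUnits.ofUnitLog p E) 3 = ∅ := by
  obtain ⟨E, hfd, hfin, π, hπ⟩ := exists_subfield_root p p p
  haveI : ProperSpace E := properSpace_subfield p E
  have hπp : π ^ p = (p : E) * (1 - π) := by linear_combination hπ
  obtain ⟨hnorm, ha⟩ := caseA_of_pow_eq hπp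
  obtain ⟨he, hf⟩ := absRamificationIdx_eq_and_residueDegree_eq_of_finrank_le p hfin hnorm
  obtain ⟨h3, h2⟩ := iterDomain_three_eq_empty p hp2 he hf hnorm ha
  exact ⟨E, hfd, he, hf, ⟨1 + π, h2⟩, h3⟩

variable {p} in
/-- **CASE (b) occurs: for every odd `p`, `E = ℚ_p(p^{1/p}) ⊆ ℚ̄_p` has `e = p`, `f = 1`, `[E : ℚ_p] ≤ p`, and
`D_n ≠ ∅` for every `n`** (abc-iut-w5-d138 gen 4's witness, now with its invariants computed).
[claim: Mochizuki2012, status: disputed] -/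
theorem exists_subfield_forall_iterDomain_nonempty' (hp2 : p ≠ 2) :
    ∃ (E : IntermediateField ℚ_[p] (PadicAlgCl p)) (_ : FiniteDimensional ℚ_[p] E),
      absRamificationIdx p E = p ∧ residueDegree p E = 1 ∧
        ∀ n : ℕ, (iterDomain (PadicLogOnUnits.ofUnitLog p E) n).Nonempty := by
  obtain ⟨E, hfd, hfin, π, hπ⟩ := exists_subfield_root p 0 p
  haveI : ProperSpace E := properSpace_subfield p E
  have hπp : π ^ p = (p : E) := by
    rw [Nat.cast_zero, zero_mul, add_zero] at hπ
    exact hπ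
  obtain ⟨hnorm, hb⟩ := caseB_of_pow_eq hπp
  obtain ⟨he, hf⟩ := absRamificationIdx_eq_and_residueDegree_eq_of_finrank_le p hfin hnorm
  exact ⟨E, hfd, he, hf, fun n => ⟨1 + π, one_add_pi_mem_iterDomain p hp2 he hf hnorm hb n⟩⟩

variable {p} in
/-- **IUTchIII:Rmk1.1.1(i)** (kurims p.28) **HEADLINE: the domains of the log-link iterates from depth `3` on are
NOT determined by `(p, e, f)`** — for every odd `p` there are finite `E₁, E₂ ⊆ ℚ̄_p`, both with
`e = p`, `f = 1`, such that `D_3(E₁) = ∅` while `D_n(E₂) ≠ ∅` for all `n`. [claim: Mochizuki2012, status: disputed] -/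
theorem exists_subfields_depth_three_differs (hp2 : p ≠ 2) :
    ∃ (E₁ E₂ : IntermediateField ℚ_[p] (PadicAlgCl p)) (_ : FiniteDimensional ℚ_[p] E₁)
      (_ : FiniteDimensional ℚ_[p] E₂),
      absRamificationIdx p E₁ = p ∧ residueDegree p E₁ = 1 ∧
        absRamificationIdx p E₂ = p ∧ residueDegree p E₂ = 1 ∧
          iterDomain (PadicLogOnUnits.ofUnitLog p E₁) 3 = ∅ ∧
            ∀ n : ℕ, (iterDomain (PadicLogOnUnits.ofUnitLog p E₂) n).Nonempty := by
  obtain ⟨E₁, hfd₁, he₁, hf₁, -, h₁⟩ := exists_subfield_iterDomain_three_eq_empty hp2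
  obtain ⟨E₂, hfd₂, he₂, hf₂, h₂⟩ := exists_subfield_forall_iterDomain_nonempty' hp2
  exact ⟨E₁, E₂, hfd₁, hfd₂, he₁, hf₁, he₂, hf₂, h₁, h₂⟩

end DepthThree

end Literature.IUT.LogThetaLattice

end
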